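import Summits.BirchSwinnertonDyer.BirchSwinnertonDyer.Theorems.ErratumRoadFiveNonSurjCornerFiveJLine
import Summits.BirchSwinnertonDyer.BirchSwinnertonDyer.Theorems.ErratumRoadFiveNonSurjCornerImageFull
import HarnessLib

/-!
# Route `ErratumRoadFive` (rung K2), crux `NonSurjCorner` (item stmt-BirchSwinnertonDyer-19065):
# THE EXACT IMAGE AT `p = 5` — a corner pair at `5` has mod-`5` image EQUAL to the normaliser of a split
# Cartan subgroup (`5Ns`, order `32`) or EQUAL to a conjugate of Zywina's `G₉` (`5S4`, order `96`);
# hence `−1 ∈ ρ̄_{E,5}(Γ_ℚ)` at every corner pair at `5`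
# (cell `bsd-stepL`, seat `bsd-stepL-corner5-p2` g5, WIDTH-LEVER lane B; `--supports stmt-BirchSwinnertonDyer-19065 --as helper`)

WHY THIS FILE. `…NonSurjCornerFiveJLine` (this lane g5) puts the image of every corner pair at `5` INSIDE a
conjugate of `G₉`; `…NonSurjCornerImageFull` (g2) shows it is EXACTLY `N(C_s(5))` when `3 ∤ #G`. This file
closes the other branch: when `3 ∣ #G` the image is ALL of `P G₉ P⁻¹`. Group theory (§1, one more
`decide` certificate over the `625` quadruples): the subgroups of `G₉` containing the torus `{diag(1,u)}`
are few (python: `4 ⊂ 8 ⊂ 16 ⊂ 32 ⊂ 96`), and an element `y` of order `3` (Cauchy) together with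
`h = diag(1,2)` already generates `G₉` — certified by exhibiting Zywina's generators as explicit words in
`h, y` for each of the `8` elements of order `3` of `G₉`. Consequences (§2): in every frame the image of a
corner pair at `5` is `N(P (* 0; 0 *) P⁻¹)` or `P G₉ P⁻¹` (`NonSurjCorner.image_five_eq_normalizer_or_eq_G9`)
— the census labels `5Ns` (12 pairs) and `5S4` (52 pairs) are the only possibilities, now as a kernel
theorem about EVERY corner pair — and `−1 ∈ ρ̄_{E,5}(Γ_ℚ)` (`NonSurjCorner.exists_smul_eq_neg_five`; g2 had it
off the octahedral branch only, and at `7`).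

HONEST FRAMING: structure theorems (no named fact beyond those of the imported files; none is used here);
nothing here proves the crux, a registered stub or BSD for any class; no census number moves (T7).
References: [Zywina2015] §1.3 (`G₉`), Thm. 1.4 (first item: the list of images at `5`); [Serre1972] §2.1 a),
§2.4 Prop. 15, §2.6 (octahedral case).
-/

set_option linter.dupNamespace false -- `Summit.BirchSwinnertonDyer.BirchSwinnertonDyer` (summit = problem), tree-wide

noncomputable section

open scoped Classical

namespace Summit.BirchSwinnertonDyer.BirchSwinnertonDyer.Theorems.ZywinaG9

open Matrix Literature.NumberTheory.GaloisRepresentations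
  Literature.NumberTheory.GaloisRepresentations.Serre1972
  Literature.NumberTheory.EllipticCurves Literature.NumberTheory.EllipticCurves.Zywina2015G9
  Literature.NumberTheory.EllipticCurves.Zywina2015G9.Quad

/-! ### §1. Group theory: an element of order `3` and the torus generate `G₉` -/

/-- **The third finite computation: an element of order `3` generates `G₉` together with the torus.**
For every invertible quadruple `y` with `y³ = 1 ≠ y`, EITHER `y` fails the explicit membership test
`inG9` (then `⟨h, y⟩` contains an element of order `5`, `Quad.cert_of_not_inG9`), OR each of Zywina's
generators `(2 0; 0 1)`, `(0 4; 1 0)`, `(1 1; 1 4)` is an explicit short word in `h = (1 0; 0 2)` and `y`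
(there are exactly `8` elements of order `3` in `G₉`; word lists found by brute force, `2 + 4 + 8`
templates). Checked by `decide`. [folklore] -/
theorem Quad.generators_mem_words_of_order_three : ∀ a b c d : ZMod 5,
    det (a, b, c, d) ≠ 0 → npow 3 (a, b, c, d) = one → ((a, b, c, d) : Quad) ≠ one →
      inG9 (a, b, c, d) = false ∨
      ((((2, 0, 0, 1) : Quad) ∈ [mul (mul (mul (mul (mul (mul (1, 0, 0, 2) (1, 0, 0, 2)) (a, b, c, d)) (1, 0, 0, 2)) (1, 0, 0, 2)) (1, 0, 0, 2)) (a, b, c, d),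
        mul (mul (mul (mul (mul (mul (mul (1, 0, 0, 2) (a, b, c, d)) (1, 0, 0, 2)) (1, 0, 0, 2)) (a, b, c, d)) (1, 0, 0, 2)) (1, 0, 0, 2)) (a, b, c, d)]) ∧
       (((0, 4, 1, 0) : Quad) ∈ [mul (mul (mul (mul (mul (mul (1, 0, 0, 2) (1, 0, 0, 2)) (a, b, c, d)) (1, 0, 0, 2)) (1, 0, 0, 2)) (a, b, c, d)) (a, b, c, d),
        mul (mul (mul (mul (mul (mul (1, 0, 0, 2) (1, 0, 0, 2)) (a, b, c, d)) (a, b, c, d)) (1, 0, 0, 2)) (1, 0, 0, 2)) (a, b, c, d),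
        mul (mul (mul (mul (mul (mul (a, b, c, d) (1, 0, 0, 2)) (1, 0, 0, 2)) (a, b, c, d)) (a, b, c, d)) (1, 0, 0, 2)) (1, 0, 0, 2),
        mul (mul (mul (mul (mul (mul (a, b, c, d) (a, b, c, d)) (1, 0, 0, 2)) (1, 0, 0, 2)) (a, b, c, d)) (1, 0, 0, 2)) (1, 0, 0, 2)]) ∧
       (((1, 1, 1, 4) : Quad) ∈ [mul (mul (mul (1, 0, 0, 2) (1, 0, 0, 2)) (1, 0, 0, 2)) (a, b, c, d),
        mul (mul (mul (1, 0, 0, 2) (1, 0, 0, 2)) (a, b, c, d)) (1, 0, 0, 2),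
        mul (mul (mul (1, 0, 0, 2) (a, b, c, d)) (1, 0, 0, 2)) (1, 0, 0, 2),
        mul (mul (mul (a, b, c, d) (1, 0, 0, 2)) (1, 0, 0, 2)) (1, 0, 0, 2),
        mul (mul (mul (mul (1, 0, 0, 2) (1, 0, 0, 2)) (1, 0, 0, 2)) (a, b, c, d)) (a, b, c, d),
        mul (mul (mul (mul (1, 0, 0, 2) (1, 0, 0, 2)) (a, b, c, d)) (a, b, c, d)) (1, 0, 0, 2),
        mul (mul (mul (mul (1, 0, 0, 2) (a, b, c, d)) (a, b, c, d)) (1, 0, 0, 2)) (1, 0, 0, 2),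
        mul (mul (mul (mul (a, b, c, d) (a, b, c, d)) (1, 0, 0, 2)) (1, 0, 0, 2)) (1, 0, 0, 2)])) := by
  decide +kernel

/-- `Quad.generators_mem_words_of_order_three` for a quadruple variable. [folklore] -/
theorem Quad.generators_mem_words_of_order_three' (y : Quad) (hdet : det y ≠ 0) (h3 : npow 3 y = one)
    (h1 : y ≠ one) :
    inG9 y = false ∨
      ((((2, 0, 0, 1) : Quad) ∈ [mul (mul (mul (mul (mul (mul (1, 0, 0, 2) (1, 0, 0, 2)) y) (1, 0, 0, 2)) (1, 0, 0, 2)) (1, 0, 0, 2)) y,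
        mul (mul (mul (mul (mul (mul (mul (1, 0, 0, 2) y) (1, 0, 0, 2)) (1, 0, 0, 2)) y) (1, 0, 0, 2)) (1, 0, 0, 2)) y]) ∧
       (((0, 4, 1, 0) : Quad) ∈ [mul (mul (mul (mul (mul (mul (1, 0, 0, 2) (1, 0, 0, 2)) y) (1, 0, 0, 2)) (1, 0, 0, 2)) y) y,
        mul (mul (mul (mul (mul (mul (1, 0, 0, 2) (1, 0, 0, 2)) y) y) (1, 0, 0, 2)) (1, 0, 0, 2)) y,
        mul (mul (mul (mul (mul (mul y (1, 0, 0, 2)) (1, 0, 0, 2)) y) y) (1, 0, 0, 2)) (1, 0, 0, 2),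
        mul (mul (mul (mul (mul (mul y y) (1, 0, 0, 2)) (1, 0, 0, 2)) y) (1, 0, 0, 2)) (1, 0, 0, 2)]) ∧
       (((1, 1, 1, 4) : Quad) ∈ [mul (mul (mul (1, 0, 0, 2) (1, 0, 0, 2)) (1, 0, 0, 2)) y,
        mul (mul (mul (1, 0, 0, 2) (1, 0, 0, 2)) y) (1, 0, 0, 2),
        mul (mul (mul (1, 0, 0, 2) y) (1, 0, 0, 2)) (1, 0, 0, 2),
        mul (mul (mul y (1, 0, 0, 2)) (1, 0, 0, 2)) (1, 0, 0, 2),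
        mul (mul (mul (mul (1, 0, 0, 2) (1, 0, 0, 2)) (1, 0, 0, 2)) y) y,
        mul (mul (mul (mul (1, 0, 0, 2) (1, 0, 0, 2)) y) y) (1, 0, 0, 2),
        mul (mul (mul (mul (1, 0, 0, 2) y) y) (1, 0, 0, 2)) (1, 0, 0, 2),
        mul (mul (mul (mul y y) (1, 0, 0, 2)) (1, 0, 0, 2)) (1, 0, 0, 2)])) := by
  obtain ⟨a, b, c, d⟩ := y
  exact Quad.generators_mem_words_of_order_three a b c d hdet h3 h1

/-- The printed third generator's entries `(0, −1, 1, 0)` are `(0, 4, 1, 0)` in `ZMod 5`. [folklore] -/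
theorem Quad.genC_entries : (((0 : ZMod 5), (-1 : ZMod 5), (1 : ZMod 5), (0 : ZMod 5)) : Quad) = (0, 4, 1, 0) := by
  decide +kernel

/-- The printed fourth generator's entries `(1, 1, 1, −1)` are `(1, 1, 1, 4)` in `ZMod 5`. [folklore] -/
theorem Quad.genD_entries : (((1 : ZMod 5), (1 : ZMod 5), (1 : ZMod 5), (-1 : ZMod 5)) : Quad) = (1, 1, 1, 4) := by
  decide +kernel

section Field

variable [Fact (Nat.Prime 5)]

/-- **An element of `H` outside the explicit test `inG9` forces `5 ∣ #H`** (given `h = diag(1,2) ∈ H`):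
the order-`5` certificate of the tool file, packaged. [folklore] -/
theorem five_dvd_card_of_mem_of_inG9_false {H : Subgroup (GL (Fin 2) (ZMod 5))} {x h : GL (Fin 2) (ZMod 5)} (hx : x ∈ H)
    (hh : h ∈ H) (hhq : Quad.ofMatrix ((h : GL (Fin 2) (ZMod 5)) : Matrix (Fin 2) (Fin 2) (ZMod 5)) = (1, 0, 0, 2))
    (hin : Quad.inG9 (Quad.ofMatrix ((x : GL (Fin 2) (ZMod 5)) : Matrix (Fin 2) (Fin 2) (ZMod 5))) = false) : 5 ∣ Nat.card H := by
  obtain ⟨i, hcert⟩ := Quad.cert_of_not_inG9' _ (det_ofMatrix_ne_zero x) hin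
  obtain ⟨h4, h20⟩ := (Quad.cert_iff _).mp hcert
  obtain ⟨w, hwmem, hofw⟩ := exists_wordGL H hx hh hhq i
  have hv1 : w ^ 4 ≠ 1 := by
    intro h1
    apply h4
    rw [← hofw, ← Quad.ofMatrix_coe_pow, h1, Units.val_one]
    exact Quad.ofMatrix_one
  have hv5 : (w ^ 4) ^ 5 = 1 := by
    apply eq_of_ofMatrix_eq
    rw [← pow_mul, Quad.ofMatrix_coe_pow, hofw, Units.val_one, Quad.ofMatrix_one]
    exact h20
  have hord : orderOf (⟨w ^ 4, H.pow_mem hwmem 4⟩ : H) = 5 := by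
    rw [Subgroup.orderOf_mk]
    exact orderOf_eq_prime hv5 hv1
  have hdvd := orderOf_dvd_natCard (⟨w ^ 4, H.pow_mem hwmem 4⟩ : H)
  rwa [hord] at hdvd

/-- **From an element of order `3`: Zywina's generators inside `H`.** If `H ≤ GL₂(𝔽₅)` has order
prime to `5` and contains `h` with entries `(1 0; 0 2)` and an element `y` of order `3`, then `H`
contains elements with entries `(2 0; 0 1)`, `(0 4; 1 0)`, `(1 1; 1 4)` (the explicit words of
`Quad.generators_mem_words_of_order_three`; the alternative `y ∉ G₉` would put an element of order `5`
in `H`, `five_dvd_card_of_mem_of_inG9_false`). [folklore] -/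
theorem exists_generators_mem_of_order_three {H : Subgroup (GL (Fin 2) (ZMod 5))} (h5 : ¬ 5 ∣ Nat.card H)
    {h y : GL (Fin 2) (ZMod 5)} (hh : h ∈ H) (hhq : Quad.ofMatrix ((h : GL (Fin 2) (ZMod 5)) : Matrix (Fin 2) (Fin 2) (ZMod 5)) = (1, 0, 0, 2))
    (hy : y ∈ H) (hy3 : y ^ 3 = 1) (hy1 : y ≠ 1) :
    (∃ g ∈ H, Quad.ofMatrix ((g : GL (Fin 2) (ZMod 5)) : Matrix (Fin 2) (Fin 2) (ZMod 5)) = (2, 0, 0, 1)) ∧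
      (∃ g ∈ H, Quad.ofMatrix ((g : GL (Fin 2) (ZMod 5)) : Matrix (Fin 2) (Fin 2) (ZMod 5)) = (0, 4, 1, 0)) ∧
      (∃ g ∈ H, Quad.ofMatrix ((g : GL (Fin 2) (ZMod 5)) : Matrix (Fin 2) (Fin 2) (ZMod 5)) = (1, 1, 1, 4)) := by
  have hq3 : Quad.npow 3 (Quad.ofMatrix ((y : GL (Fin 2) (ZMod 5)) : Matrix (Fin 2) (Fin 2) (ZMod 5))) = Quad.one := by
    rw [← Quad.ofMatrix_coe_pow, hy3, Units.val_one, Quad.ofMatrix_one]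
  have hq1 : Quad.ofMatrix ((y : GL (Fin 2) (ZMod 5)) : Matrix (Fin 2) (Fin 2) (ZMod 5)) ≠ Quad.one := by
    intro h1
    exact hy1 (eq_of_ofMatrix_eq (by rw [h1, Units.val_one, Quad.ofMatrix_one]))
  rcases Quad.generators_mem_words_of_order_three' _ (det_ofMatrix_ne_zero y) hq3 hq1 with
    hin | ⟨hA, hC, hD⟩
  · exact absurd (five_dvd_card_of_mem_of_inG9_false hy hh hhq hin) h5
  refine ⟨?_, ?_, ?_⟩
  · -- `(2 0; 0 1)`
    simp only [List.mem_cons, List.not_mem_nil, or_false] at hA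
    rcases hA with hA | hA
    · exact ⟨h * h * y * h * h * h * y, H.mul_mem (H.mul_mem (H.mul_mem (H.mul_mem (H.mul_mem (H.mul_mem hh hh) hy) hh) hh) hh) hy, by
        simp only [Quad.ofMatrix_coe_mul, hhq]; exact hA.symm⟩
    · exact ⟨h * y * h * h * y * h * h * y, H.mul_mem (H.mul_mem (H.mul_mem (H.mul_mem (H.mul_mem (H.mul_mem (H.mul_mem hh hy) hh) hh) hy) hh) hh) hy, by
        simp only [Quad.ofMatrix_coe_mul, hhq]; exact hA.symm⟩
  · -- `(0 4; 1 0)`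
    simp only [List.mem_cons, List.not_mem_nil, or_false] at hC
    rcases hC with hC | hC | hC | hC
    · exact ⟨h * h * y * h * h * y * y, H.mul_mem (H.mul_mem (H.mul_mem (H.mul_mem (H.mul_mem (H.mul_mem hh hh) hy) hh) hh) hy) hy, by
        simp only [Quad.ofMatrix_coe_mul, hhq]; exact hC.symm⟩
    · exact ⟨h * h * y * y * h * h * y, H.mul_mem (H.mul_mem (H.mul_mem (H.mul_mem (H.mul_mem (H.mul_mem hh hh) hy) hy) hh) hh) hy, by
        simp only [Quad.ofMatrix_coe_mul, hhq]; exact hC.symm⟩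
    · exact ⟨y * h * h * y * y * h * h, H.mul_mem (H.mul_mem (H.mul_mem (H.mul_mem (H.mul_mem (H.mul_mem hy hh) hh) hy) hy) hh) hh, by
        simp only [Quad.ofMatrix_coe_mul, hhq]; exact hC.symm⟩
    · exact ⟨y * y * h * h * y * h * h, H.mul_mem (H.mul_mem (H.mul_mem (H.mul_mem (H.mul_mem (H.mul_mem hy hy) hh) hh) hy) hh) hh, by
        simp only [Quad.ofMatrix_coe_mul, hhq]; exact hC.symm⟩
  · -- `(1 1; 1 4)`
    simp only [List.mem_cons, List.not_mem_nil, or_false] at hD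
    rcases hD with hD | hD | hD | hD | hD | hD | hD | hD
    · exact ⟨h * h * h * y, H.mul_mem (H.mul_mem (H.mul_mem hh hh) hh) hy, by
        simp only [Quad.ofMatrix_coe_mul, hhq]; exact hD.symm⟩
    · exact ⟨h * h * y * h, H.mul_mem (H.mul_mem (H.mul_mem hh hh) hy) hh, by
        simp only [Quad.ofMatrix_coe_mul, hhq]; exact hD.symm⟩
    · exact ⟨h * y * h * h, H.mul_mem (H.mul_mem (H.mul_mem hh hy) hh) hh, by
        simp only [Quad.ofMatrix_coe_mul, hhq]; exact hD.symm⟩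
    · exact ⟨y * h * h * h, H.mul_mem (H.mul_mem (H.mul_mem hy hh) hh) hh, by
        simp only [Quad.ofMatrix_coe_mul, hhq]; exact hD.symm⟩
    · exact ⟨h * h * h * y * y, H.mul_mem (H.mul_mem (H.mul_mem (H.mul_mem hh hh) hh) hy) hy, by
        simp only [Quad.ofMatrix_coe_mul, hhq]; exact hD.symm⟩
    · exact ⟨h * h * y * y * h, H.mul_mem (H.mul_mem (H.mul_mem (H.mul_mem hh hh) hy) hy) hh, by
        simp only [Quad.ofMatrix_coe_mul, hhq]; exact hD.symm⟩
    · exact ⟨h * y * y * h * h, H.mul_mem (H.mul_mem (H.mul_mem (H.mul_mem hh hy) hy) hh) hh, by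
        simp only [Quad.ofMatrix_coe_mul, hhq]; exact hD.symm⟩
    · exact ⟨y * y * h * h * h, H.mul_mem (H.mul_mem (H.mul_mem (H.mul_mem hy hy) hh) hh) hh, by
        simp only [Quad.ofMatrix_coe_mul, hhq]; exact hD.symm⟩

/-- `GL₂(𝔽₅)` is finite. [folklore] -/
theorem finite_GL : Finite (GL (Fin 2) (ZMod 5)) :=
  Finite.of_injective (fun g : GL (Fin 2) (ZMod 5) => ((g : GL (Fin 2) (ZMod 5)) : Matrix (Fin 2) (Fin 2) (ZMod 5))) Units.val_injective

/-- **Exact form, diagonal frame.** A subgroup `H ≤ GL₂(𝔽₅)` of order prime to `5` and divisible by `3`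
containing the torus `{diag(1,u)}` IS Zywina's `G₉` (`≤` by the tool file; `≥`: Cauchy gives an element
of order `3`, which with `diag(1,2)` produces all four generators). [folklore] -/
theorem eq_G9_of_halfDiagonalSubgroup_le_of_three_dvd {H : Subgroup (GL (Fin 2) (ZMod 5))} (h5 : ¬ 5 ∣ Nat.card H)
    (h3 : 3 ∣ Nat.card H) (hT : halfDiagonalSubgroup (ZMod 5) ≤ H) : H = G9 := by
  refine le_antisymm (le_G9_of_halfDiagonalSubgroup_le h5 hT) ?_
  haveI : Finite (GL (Fin 2) (ZMod 5)) := finite_GL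
  haveI : Fact (Nat.Prime 3) := ⟨by decide⟩
  obtain ⟨y, hy⟩ := exists_prime_orderOf_dvd_card' (G := H) 3 h3
  have hy3 : (y : GL (Fin 2) (ZMod 5)) ^ 3 = 1 := by
    rw [← Subgroup.orderOf_coe] at hy
    rw [← hy]; exact pow_orderOf_eq_one _
  have hy1 : (y : GL (Fin 2) (ZMod 5)) ≠ 1 := by
    intro h1
    rw [← Subgroup.orderOf_coe, h1, orderOf_one] at hy
    exact absurd hy (by decide)
  obtain ⟨-, h, -, -, -, -, hhq, -, -⟩ := exists_generators
  have hh : h ∈ H := hT (mem_halfDiagonalSubgroup_of_ofMatrix_eq hhq)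
  obtain ⟨⟨gA, hA, hAq⟩, ⟨gC, hC, hCq⟩, ⟨gD, hD, hDq⟩⟩ :=
    exists_generators_mem_of_order_three h5 hh hhq y.2 hy3 hy1
  rw [G9, Subgroup.closure_le]
  intro g hg
  simp only [generatorQuads, Set.mem_insert_iff, Set.mem_singleton_iff, Set.mem_setOf_eq] at hg
  rcases hg with hg | hg | hg | hg
  · rw [eq_of_ofMatrix_eq (hg.trans hAq.symm)]; exact hA
  · rw [eq_of_ofMatrix_eq (hg.trans hhq.symm)]; exact hh
  · rw [eq_of_ofMatrix_eq ((hg.trans Quad.genC_entries).trans hCq.symm)]; exact hC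
  · rw [eq_of_ofMatrix_eq ((hg.trans Quad.genD_entries).trans hDq.symm)]; exact hD

/-- **Exact form, any frame.** A subgroup `H ≤ GL₂(𝔽₅)` with `5 ∤ #H`, `3 ∣ #H` containing a split
half-Cartan subgroup `P (1 0; 0 *) P⁻¹` EQUALS the conjugate `P G₉ P⁻¹`. [folklore] -/
theorem eq_map_G9_of_halfSplitCartan_le_of_three_dvd {H : Subgroup (GL (Fin 2) (ZMod 5))} (h5 : ¬ 5 ∣ Nat.card H)
    (h3 : 3 ∣ Nat.card H) {P : GL (Fin 2) (ZMod 5)} (hT : halfSplitCartan P ≤ H) :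
    H = G9.map (MulAut.conj P).toMonoidHom := by
  let f : GL (Fin 2) (ZMod 5) →* GL (Fin 2) (ZMod 5) := (MulAut.conj P⁻¹).toMonoidHom
  have hf : Function.Injective f := fun a b hab => (MulAut.conj P⁻¹).injective hab
  let H' : Subgroup (GL (Fin 2) (ZMod 5)) := H.map f
  have hcard : Nat.card H' = Nat.card H := Subgroup.card_map_of_injective hf
  have hT' : halfDiagonalSubgroup (ZMod 5) ≤ H' := by
    intro d hd
    have hPd : (MulAut.conj P).toMonoidHom d ∈ H := hT ⟨d, hd, rfl⟩
    refine ⟨(MulAut.conj P).toMonoidHom d, hPd, ?_⟩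
    change P⁻¹ * (P * d * P⁻¹) * P⁻¹⁻¹ = d
    group
  have h5' : ¬ 5 ∣ Nat.card H' := by rw [hcard]; exact h5
  have h3' : 3 ∣ Nat.card H' := by rw [hcard]; exact h3
  have hH' : H' = G9 := eq_G9_of_halfDiagonalSubgroup_le_of_three_dvd h5' h3' hT'
  have hback : H = H'.map (MulAut.conj P).toMonoidHom := by
    ext x
    constructor
    · intro hx
      exact ⟨f x, ⟨x, hx, rfl⟩, by change P * (P⁻¹ * x * P⁻¹⁻¹) * P⁻¹ = x; group⟩
    · rintro ⟨x', ⟨x0, hx0, rfl⟩, rfl⟩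
      have : (MulAut.conj P).toMonoidHom (f x0) = x0 := by
        change P * (P⁻¹ * x0 * P⁻¹⁻¹) * P⁻¹ = x0; group
      rw [this]; exact hx0
  rw [hback, hH']

/-- `−1 ∈ G₉` (`−1 = gD⁴`: `gD² = 2`, `2² = 4 = −1`). [cite: Zywina2015, §1.3 ("Each of the groups G_i contain −I")] -/
theorem neg_one_mem_G9 : (-1 : GL (Fin 2) (ZMod 5)) ∈ G9 := by
  obtain ⟨-, -, -, gD, ⟨-, -, -, hDm⟩, -, -, -, hD⟩ := exists_generators
  have h : (-1 : GL (Fin 2) (ZMod 5)) = gD ^ 4 := by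
    apply eq_of_ofMatrix_eq
    rw [Quad.ofMatrix_coe_pow, hD, Units.val_neg, Units.val_one]
    decide +kernel
  rw [h]; exact G9.pow_mem hDm 4

end Field

end Summit.BirchSwinnertonDyer.BirchSwinnertonDyer.Theorems.ZywinaG9

/-! ### §2. The corner at `5`: exact image and `−1` -/

namespace Summit.BirchSwinnertonDyer.BirchSwinnertonDyer.Theorems.CornerShape

open scoped Classical NumberField MatrixGroups
open IsDedekindDomain Field Matrix NumberField WeierstrassCurve
  Literature.NumberTheory.EllipticCurves
  Literature.NumberTheory.EllipticCurves.Rank1Residual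
  Literature.NumberTheory.EllipticCurves.Zywina2015G9
  Literature.NumberTheory.GaloisRepresentations
  Literature.NumberTheory.GaloisRepresentations.Serre1972
  Rat.HeightOneSpectrum
  Summit.BirchSwinnertonDyer.Rank1Residual
  Summit.BirchSwinnertonDyer.BirchSwinnertonDyer.Theorems.ZywinaG9

/-- **`Mult ∧ Irr ∧ ¬Surj` at `5` with `3 ∣ #G`: the image IS a conjugate of `G₉`.** In any frame
`(e, Φ)`: `5 ∤ #G` (Serre Prop. 15), the inertia at `5` gives a split half-Cartan subgroup
`P (1 0; 0 *) P⁻¹ ≤ G` (Serre §1.12 + §2.1 a), x11c), and §1's exact form.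
[cite: Serre1972, §1.12, §2.1 a), §2.4 Prop. 15, §2.6] [cite: Zywina2015, §1.3 (G₉)] -/
theorem image_eq_map_G9_of_three_dvd (W : WeierstrassCurve ℚ) [W.IsElliptic] [Fact (Nat.Prime 5)]
    (Φ : Multiplicative (AddAut (geomTorsion W 5)) ≃* GL (Fin 2) (ZMod 5))
    (e : geomTorsion W 5 ≃+ (Fin 2 → ZMod 5))
    (he : ∀ (g : Multiplicative (AddAut (geomTorsion W 5))) (x : geomTorsion W 5),
      e (Multiplicative.toAdd g x) = ((Φ g : GL (Fin 2) (ZMod 5)) : Matrix (Fin 2) (Fin 2) (ZMod 5)) *ᵥ e x)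
    (hmult : Mult W 5) (hirr : Irr W 5) (hns : ¬ Surj W 5)
    (h3 : 3 ∣ Nat.card ((galoisRepTorsion W 5).range.map Φ.toMonoidHom)) :
    ∃ P : GL (Fin 2) (ZMod 5), (galoisRepTorsion W 5).range.map Φ.toMonoidHom = G9.map (MulAut.conj P).toMonoidHom := by
  have hpG : ¬ 5 ∣ Nat.card ((galoisRepTorsion W 5).range.map Φ.toMonoidHom) :=
    not_dvd_card_of_not_hasSurjectiveModNGaloisRep W 5 Φ e he hirr hns
  have hpp : Nat.Prime 5 := Fact.out
  set v : HeightOneSpectrum (𝓞 ℚ) := (primesEquiv (R := 𝓞 ℚ)).symm ⟨5, hpp⟩ with hvdef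
  have hv' : primesEquiv v = ⟨5, hpp⟩ := Equiv.apply_symm_apply _ _
  have hv : (primesEquiv v : ℕ) = 5 := congrArg Subtype.val hv'
  obtain ⟨𝔏, h𝔏⟩ := HeightOneSpectrum.primesAbove_nonempty v
  obtain ⟨P, hP⟩ :=
    GaloisImage.exists_halfSplitCartan_eq_inertia_image_of_mult W 5 Φ e he (by decide) hmult hpG hv h𝔏
  have hCG : halfSplitCartan P ≤ (galoisRepTorsion W 5).range.map Φ.toMonoidHom := by
    rw [← hP]
    exact Subgroup.map_mono (fun x ⟨τ, _, hτ⟩ ↦ ⟨τ, hτ⟩)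
  exact ⟨P, eq_map_G9_of_halfSplitCartan_le_of_three_dvd hpG h3 hCG⟩

/-- **THE EXACT IMAGE OF A CORNER PAIR AT `5`.** For `(E, 5)` in class X11b with `ρ̄_{E,5}` not onto and
any frame `(e, Φ)` of `E[5]`: the image `Φ(ρ̄(Γ_ℚ))` is EITHER the full normaliser `N(P (* 0; 0 *) P⁻¹)` of a
split Cartan subgroup (label `5Ns`, order `32`; this lane g2, the branch `3 ∤ #G`) OR the conjugate
`P G₉ P⁻¹` of Zywina's `G₉` (label `5S4`, order `96`; the branch `3 ∣ #G`). The census corner at `5` has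
12 + 52 pairs of the two kinds; the theorem says no third kind exists anywhere on the corner.
[cite: Zywina2015, §1.3, Thm. 1.4] [cite: Serre1972, §2.2, §2.6] -/
theorem NonSurjCorner.image_five_eq_normalizer_or_eq_G9 (W : WeierstrassCurve ℚ) [W.IsElliptic]
    [W.IsGloballyMinimal] [Fact (Nat.Prime 5)] (hX : ClassX11b W 5) (hns : ¬ Surj W 5)
    (Φ : Multiplicative (AddAut (geomTorsion W 5)) ≃* GL (Fin 2) (ZMod 5))
    (e : geomTorsion W 5 ≃+ (Fin 2 → ZMod 5))
    (he : ∀ (g : Multiplicative (AddAut (geomTorsion W 5))) (x : geomTorsion W 5),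
      e (Multiplicative.toAdd g x) = ((Φ g : GL (Fin 2) (ZMod 5)) : Matrix (Fin 2) (Fin 2) (ZMod 5)) *ᵥ e x) :
    (∃ P : GL (Fin 2) (ZMod 5), (galoisRepTorsion W 5).range.map Φ.toMonoidHom =
        Subgroup.normalizer (splitCartan P : Set (GL (Fin 2) (ZMod 5)))) ∨
      (∃ P : GL (Fin 2) (ZMod 5), (galoisRepTorsion W 5).range.map Φ.toMonoidHom =
        G9.map (MulAut.conj P).toMonoidHom) := by
  by_cases h3 : 3 ∣ Nat.card ((galoisRepTorsion W 5).range.map Φ.toMonoidHom)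
  · exact Or.inr (image_eq_map_G9_of_three_dvd W Φ e he hX.2.2.1 hX.2.2.2 hns h3)
  · exact Or.inl (image_eq_normalizer_splitCartan_of_not_three_dvd W 5 Φ e he le_rfl hX.2.2.1 hX.2.2.2
      hns h3)

/-- **`−1 ∈ ρ̄_{E,5}(Γ_ℚ)` at EVERY corner pair at `5`**: some `γ ∈ Γ_ℚ` acts as `−1` on `E[5]` (both exact
images contain `−1`: `−1 ∈ P (* 0; 0 *) P⁻¹ ≤ N`, and `−1 = gD⁴ ∈ G₉` is central). g2 had this off the
octahedral branch (`exists_smul_eq_neg_of_not_three_dvd`) and at `7` (`NonSurjCorner.exists_smul_eq_neg_seven`);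
this closes `p = 5`. [cite: Zywina2015, §1.3 ("Each of the groups G_i contain −I")] [cite: Serre1972, §2.2] -/
theorem NonSurjCorner.exists_smul_eq_neg_five (W : WeierstrassCurve ℚ) [W.IsElliptic] [W.IsGloballyMinimal]
    [Fact (Nat.Prime 5)] (hX : ClassX11b W 5) (hns : ¬ Surj W 5) :
    ∃ γ : absoluteGaloisGroup ℚ, ∀ x : geomTorsion W ((5 : ℕ) : ℤ), γ • x = -x := by
  obtain ⟨e, Φ, he, -⟩ := exists_frame_galoisRepTorsion_rat W 5
  have hmem : (-1 : GL (Fin 2) (ZMod 5)) ∈ (galoisRepTorsion W 5).range.map Φ.toMonoidHom := by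
    rcases NonSurjCorner.image_five_eq_normalizer_or_eq_G9 W hX hns Φ e he with ⟨P, hG⟩ | ⟨P, hG⟩
    · rw [hG]; exact Subgroup.le_normalizer (neg_one_mem_splitCartan P)
    · rw [hG]
      refine ⟨-1, neg_one_mem_G9, ?_⟩
      rw [MulEquiv.coe_toMonoidHom, MulAut.conj_apply, mul_neg_one, neg_mul, mul_inv_cancel]
  obtain ⟨γ, hγ⟩ := (mem_map_range_galoisRepTorsion_iff W 5 Φ).mp hmem
  exact ⟨γ, smul_eq_neg_of_apply_eq_neg_one W 5 Φ e he hγ⟩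

end Summit.BirchSwinnertonDyer.BirchSwinnertonDyer.Theorems.CornerShape

end
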